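import Mathlib
import HarnessLib
import Summits.Parity.GeneralizedHardyLittlewood.Theses.LeeYangFibres
import Summits.Parity.GeneralizedHardyLittlewood.Theorems.LeeYangFibresAbsoluteUpgradeDipDefs
import Summits.Parity.GeneralizedHardyLittlewood.Theorems.LeeYangFibresFibreHyperbolicityAlongDefs
import Summits.Parity.GeneralizedHardyLittlewood.Theorems.LeeYangFibresFibreHyperbolicityAlongTransferAlong
import Summits.Parity.GeneralizedHardyLittlewood.Theorems.LeeYangFibresFibreHyperbolicityAlongRankOneAlong
import Summits.Parity.GeneralizedHardyLittlewood.Theorems.LeeYangFibresFibreHyperbolicityAlongGhostFreeAlong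
import Summits.Parity.GeneralizedHardyLittlewood.Theorems.LeeYangFibresFibreHyperbolicityAlongSiftedSinglesAlong
import Summits.Parity.GeneralizedHardyLittlewood.Theorems.LeeYangFibresFibreHyperbolicityAlongRobustRow
import Summits.Parity.GeneralizedHardyLittlewood.Theorems.LeeYangFibresFibreHyperbolicityAlongMarginGeometry
import Summits.Parity.GeneralizedHardyLittlewood.Theorems.AbsoluteUpgrade.Negative.FibreHyperbolicityAlongLoadBearing

/-!
# Crux `FibreHyperbolicityAlong` (stmt-Parity-18103) — line `sifted-chowla-distillation` (skeleton v4)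

NECESSITY (landed p165401/p164094, `stub_mixedPolyOfAlong`, Theorems/…AlongNecessity{,Aux}): crux ∧ law ⟹ every sifted |S|-point
Liouville correlation over the rough tuples (S ≠ ∅, mass ≥ ηN) has saving `U^{-m}` for EVERY `m` — so the open stub `stub_siftedChowlaMixedAlong`
(saving `e^{-CU}`) is SANDWICHED: sufficient (this composition) and necessary up to the shape of the saving (kernel-checked both ways).

STATUS v4 (lead, 2026-08-17, after waves 1–2; v4 adds: `stub_robustRowExp` DERIVED from the landed reduction
`stub_robustRowOfLobeMargin` p162910 and the new open parity-free stub `stub_modelLobeMargin`; zero-geometry sufficiency landed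
p162733/p162517; Defs append p161783).  v3:  LANDED (tree, sorry-free, imported here): the vocabulary
`Theorems/LeeYangFibresFibreHyperbolicityAlongDefs` (p158503; objects, the five statement types, `stub_glueAlong`),
`stub_transferAlong` (p159508, …AlongTransferAlong), `stub_rankOneAlong` (p159761, …AlongRankOneAlong), `stub_ghostFreeAlong`
(p160256, …AlongGhostFreeAlong), and the two helper stubs of the singles proof `stub_sharpFundamentalLemma` (p161343,
…AlongSiftedSinglesAlongSieve: the SHARP Fundamental Lemma, every exponential rate, from the tree's Iwaniec Rosser sieve) and
`stub_siftedSinglesAtScale` (p161345, …AlongSiftedSinglesAlongScale), and `stub_siftedSinglesAlong` itself (p161687,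
…AlongSiftedSinglesAlong: sifted singles along the schedule for EVERY C).  OPEN: `stub_cellParityLawSaving` (= item 18104), `stub_siftedChowlaMixedAlong` (THE parity
content), `stub_robustRowExp` (parity-free; reduced sorry-free by the wave to `ModelLobeMargin`, a u-uniform lobe certificate of the
Buchstab–Dickman row — reshape pending a Defs home for that statement).  The objects and statements below are now the tree's
(`import …AlongDefs`); only the open stubs keep a `sorry` here.


LEAD RESHAPE (prover-line-stmt-Parity-18103-0, 2026-08-17, cycle 1; composition idea unchanged, 7 stubs): the
strategist's `stub_walshAlong : law → singles → mixed → CellsNearRankOneAlong` is split at the natural seam into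
`stub_ghostFreeAlong : law → singles → mixed → GhostFreeLawAlong` (pure Walsh inversion over the parity classes:
the `2^t − 1` amplitudes `θ_S` are the normalised sifted Liouville correlations, the finite-`N` parity balance `β̂`
is the singles stub at `t = 1` for the identity form on `[1,N]` — no Dickman identity enters) and
`stub_rankOneAlong : GhostFreeLawAlong → CellsNearRankOneAlong` (anatomy bookkeeping: the PROVED `AnatomyAlong`,
the density floor `I_{U-1}(U) ≥ 1/((U-2)!(U-1)!)`, the mass floor).  `GhostFreeLawAlong` = the cell-parity law
along the schedule with every ghost amplitude clipped to relative `e^{-CU}` (for every `C`; `δ` existential).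

Route `LeeYangFibres`; crux = fibre hyperbolicity of the joint rough-cell polynomial ALONG THE SCHEDULE
`u = U(N) = slowDegree N = max 4 ⌊√(log log N)/2⌋` (`Theses.LeeYangFibres.FibreHyperbolicityAlong`,
definitionally `DipMarginRateExchange.FibreHyperbolicityAlong`).  Registered by the crux-strategist seat
`planner-cstrat-stmt-Parity-18103-0` (2026-08-17) together with `STRATEGY-CENSUS.md`; card `Lines/sifted-chowla-distillation.md`.

THE LINE (one paragraph).  Along the schedule every coefficient-based proof of the crux is a RACE between the
relative accuracy to which the fibre coefficients are known and the real-rootedness robustness radius of the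
Buchstab–Dickman row `F_U(ζ) = Σ_m I_m(U) ζ^m` (`θ*(U) ≈ 7.5·e^{-0.94U}`, certified numerically to `U = 300`;
`stub_robustRowExp` is its parity-free lower bound `≥ e^{-CU}`).  The coefficients are the joint cells; by the route's
own cell-parity law (`stub_cellParityLawSaving` = item stmt-Parity-18104, shared) they equal the rank-one model up to
the `2^t - 1` Walsh amplitudes `θ_S`, and `θ_S` IS — by Walsh inversion over the parity classes, `stub_walshAlong` —
the normalised SIFTED LIOUVILLE CORRELATION `Σ_{rough tuples} ∏_{i∈S} λ(ψ_i(n))`.  So the crux distils into: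
singles `|S| = 1` (`stub_siftedSinglesAlong`: PROVABLE NOW — structured-sequence sieve in the fundamental-lemma regime
`s = U/2 → ∞`, accuracy `(U/2)^{-U/2} ≪ e^{-CU}`), mixed `|S| ≥ 2` (`stub_siftedChowlaMixedAlong`: sifted `|S|`-point
Chowla along the schedule with saving `e^{-CU}` for every `C`, shift-uniform — THE OPEN PARITY CONTENT, summit-adjacent;
census §2), the parity-free robustness (`stub_robustRowExp`, XL analysis), and two transfer lemmas
(`stub_walshAlong`, `stub_transferAlong`, M–L, patterns landed at fixed `u`: `ModelTransfer.stub_perturb/coeffBound/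
assemble`, p86826/p86706/p88012, and along the schedule `QuantClip*`, p114484).  `FibreHyperbolicityAlong_of` composes
them sorry-free and concludes the crux BY NAME.

HONEST LABEL (census §5).  With `stub_cellParityLawSaving` and the two sifted-Chowla stubs one gets `DimOne` WITHOUT the
crux (census `bypass`: the law + POLYNOMIAL decay `U^{-m}` of `θ_S` already feeds `CellsToDimOne`, p100021); the zero
locus is a detour that even over-delivers (`e^{-CU}` where `U^{-m}` suffices).  The line is registered so that (i) the
continuation lead and the human see the crux's open content in the field's standard currency, typed and checked, and
(ii) the two PROVABLE stubs of stand-alone value (`stub_robustRowExp`: zeros of the Buchstab–Dickman `Ω`-row;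
`stub_siftedSinglesAlong`: Liouville in sifted tuples, Siegel-proof) can be claimed and banked.  Nobody should mistake
`stub_siftedChowlaMixedAlong` for an M-sized lemma: it is sifted Chowla at a fixed system in natural density.

DISPROOF USED.  No `Cruxes/FibreHyperbolicityAlong/Disproof.lean` exists yet (gen 1).  Honoured instead: the landed
`Theorems/AbsoluteUpgrade/Negative/FibreHyperbolicityAlongLoadBearing.lean` (IMPORTED; re-checked in the `example`s at the
end): mass floor — used in `stub_walshAlong` (θ_S is normalised by `β_∞𝔖 A^t ≥ ηN(…)^t`); convexity — threaded verbatim;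
`w_k > 0` — used in `stub_transferAlong` (`G_i(w) = ∏_{k≠i} F̃(w_k) > 0`); hidden "inhabited cell" — `stub_transferAlong`
produces a NON-ZERO polynomial (`M > 0`, `I_1 = 1`).  The fixed-degree sibling's `Cruxes/FibreHyperbolicity/Disproof.lean`
(`toy_fibre_nonreal`, `cofinalModel_of_fibreHyperbolicity`, Siegel remark) and `DisproofAnalysis.md` are respected: every
statement here is eventual in `N`, and the Siegel sensitivity sits in `stub_siftedChowlaMixedAlong` (census N2).
-/

noncomputable section

namespace Summit.Parity.GeneralizedHardyLittlewood.Cruxes.FibreHyperbolicityAlong.SiftedChowlaDistillation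

open scoped BigOperators Classical
open Literature.NumberTheory.Sieve
open Summit.Parity.GeneralizedHardyLittlewood.Theses.LeeYangFibres (CellParityLawSaving)
open Summit.Parity.GeneralizedHardyLittlewood.Cruxes.AbsoluteUpgrade.DipMarginRateExchange (slowDegree)
open Summit.Parity.GeneralizedHardyLittlewood.Cruxes.ModelHyperbolicity.WindowChainTransport (cellDensity)
open Summit.Parity.GeneralizedHardyLittlewood.Cruxes.FibreHyperbolicity.ModelTransfer (jointCell fibre)
open Summit.Parity.GeneralizedHardyLittlewood.Cruxes.AbsoluteUpgrade.NlcCellsAbsoluteClip (roughTuples)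
open Summit.Parity.GeneralizedHardyLittlewood.Theorems.ModelHyperbolicity.Negative (cell)

/-! ## Objects and statements of the line

All in the tree now: `import Summits.Parity.GeneralizedHardyLittlewood.Theorems.LeeYangFibresFibreHyperbolicityAlongDefs`
(`siftedLiouvilleCorr`, `rowTol`, `SiftedSinglesAlong`, `SiftedChowlaMixedAlong`, `RobustRowExp`, `GhostFreeLawAlong`,
`CellsNearRankOneAlong`, `stub_glueAlong`). -/

/-! ## Registered stubs -/

/-- **Stub (shared INPUT = item stmt-Parity-18104, the route's other load-bearing crux).**  The cell-parity law along the
schedule with a log-power saving.  Delegated: it is staffed as its own item; listed here because the line consumes it. -/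
theorem stub_cellParityLawSaving : CellParityLawSaving := by
  sorry

/-- **Stub (OPEN — the parity content; summit-adjacent, census §2/§4).**  Sifted mixed Chowla along the schedule. -/
theorem stub_siftedChowlaMixedAlong : SiftedChowlaMixedAlong := by
  sorry

/-- **Stub (PARITY-FREE, OPEN analytic — skeleton v4).**  The lobe certificate with exponential margin of the
Buchstab–Dickman row `F_u` (`ModelLobeMargin`, vocabulary file §RowResidue): the one analytic fact the tree lacks
(`ModGammaDisc` pins only the `O(1)` zeros near `-1,…,-K`; `ModelSimple`/`WindowChain` are qualitative).  Sufficient: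
the zero geometry `ModelZeroGeometry` (corrected Conjecture G), by the LANDED `stub_lobeMarginOfZeroGeometry`
(p162733/p162517).  Numerically `θ*(u) ≈ 7.5e^{-0.94u}` (u ≤ 300), top zero `≈ e^{0.8u}`: expected for every `C ≳ 2`. -/
theorem stub_modelLobeMargin : ModelLobeMargin := by
  sorry

/-- **Former stub `stub_robustRowExp`, now DERIVED (skeleton v4):** exponential robustness radius of the
Buchstab–Dickman row = the LANDED reduction `stub_robustRowOfLobeMargin` (p162910: lobe certificate + sign
alternation ⇒ `≥ u-2` real roots, degree `≤ u-1` ⇒ split) applied to the open lobe certificate. -/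
theorem stub_robustRowExp : RobustRowExp :=
  stub_robustRowOfLobeMargin stub_modelLobeMargin

/-! ## Landed stubs (tree theorems, imported): `stub_siftedSinglesAlong` (p161687), `stub_ghostFreeAlong` (p160256),
`stub_rankOneAlong` (p159761), `stub_transferAlong` (p159508) — composed below BY NAME. -/

/-! ## Composition (sorry-free): the crux BY NAME -/

/-- **The crux from the stubs.** -/
theorem FibreHyperbolicityAlong_of : Theses.LeeYangFibres.FibreHyperbolicityAlong :=
  stub_transferAlong
    (stub_rankOneAlong
      (stub_ghostFreeAlong stub_cellParityLawSaving stub_siftedSinglesAlong stub_siftedChowlaMixedAlong))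
    stub_robustRowExp

/-- Hypothetical form (no stub constants): the composition is pure logic. -/
example (hL : CellParityLawSaving) (h1 : SiftedSinglesAlong) (h2 : SiftedChowlaMixedAlong) (hR : RobustRowExp)
    (hG : CellParityLawSaving → SiftedSinglesAlong → SiftedChowlaMixedAlong → GhostFreeLawAlong)
    (hA : GhostFreeLawAlong → CellsNearRankOneAlong)
    (hT : CellsNearRankOneAlong → RobustRowExp → AbsoluteUpgrade.DipMarginRateExchange.FibreHyperbolicityAlong) :
    Theses.LeeYangFibres.FibreHyperbolicityAlong :=
  hT (hA (hG hL h1 h2)) hR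

/-! ## Landed Negative lemmas re-checked (the load-bearing hypotheses this line must keep) -/

example := @Theorems.AbsoluteUpgrade.Negative.fibreHyperbolicityAlong_false_without_massFloor
example := @Theorems.AbsoluteUpgrade.Negative.fibreHyperbolicityAlong_false_without_convexity
example := @Theorems.AbsoluteUpgrade.Negative.fibreHyperbolicityAlong_false_without_fugacityPositivity

end Summit.Parity.GeneralizedHardyLittlewood.Cruxes.FibreHyperbolicityAlong.SiftedChowlaDistillation
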